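import Mathlib
import Summits.Ventures.PercRepro.TriangleCapThreeBelowOneTriangleC
import Summits.Ventures.PercRepro.TriangleCapThreeTrianglesF

/-!
# PercRepro — THREE BELOW THE DIAGONAL, ONE TRIANGLE, NO OUTER VERTEX, PART D: THE RESIDUE AND THE THEOREM
(p3, gen 38; part 105)

When `2 (ab + bc + ca) < 2n + e` (the Mantel case of part C fails), `ab + bc + ca < 2n`, so for `n ≥ 9` — or for
`n ≥ 6` at `m = 3k − 12`, where `ab + bc + ca ≤ 2n − 4` — two private sets have total size `≤ 2`
(`partition_small_of_sigma_lt`); say `B = Sᶜ ∖ N(u)`, `|B| ≤ 2`, `A = N(u) ∩ Sᶜ` independent.  `|B| ≤ 1`, or `|B| = 2`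
with its two vertices adjacent (disjoint neighbourhoods in `A`), makes `Q′ ≤ 2n − 2`, not dense (`n ≤ 5`).  Else
`B = {x, y}` independent: every edge inside `Sᶜ` joins `A` to `B`, `d(z) ≤ 2` on `A`, `d(x) + d(y) = e`,
`d(x), d(y) ≤ |A| = n − 2`, so `sqP ≤ 2e + d(x)² + d(y)² ≤ 2e + (n−2)² + (e − n + 2)²` (convexity,
`sq_add_sq_le_of_sum`), `sq ≤ (n−2)² + 4`, and with `e ∈ {2n − 6, 2n − 5}` (`e ≥ 2n − 6` by the density,
`e ≤ 2n − 4` by the degrees, `e ≠ 2n − 4` by `m ≠ 3k − 10`) the count gives `Σ deficit ≥ 10n − 20` resp.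
`8n − 12 ≥ 6n` (`residue_arith`): **`one_triangle_stability_three_no_outer_residue`**.
**`one_triangle_stability_three_no_outer`**: `K₄⁻`-free, the only triangle `u v w`, no outer vertex, `k ≥ 9`,
`2m ≥ 6k − 24`, `2m ≠ 6k − 20`, and (`k ≥ 12` or `2m = 6k − 24`) ⇒ `Σ_v d(v)² + 3 (k − 4) ≤ m k`.
The exclusion `m ≠ 3k − 10` is necessary: `K_{2, k−5}` between two private sets is a `K₄⁻`-free graph with one
triangle and `Σ_v d(v)² = mk − 3(k − 4) + 4` (mining/p3/g38/tri3b.c: min gap `−4` at `(9, 17)`, `(10, 20)`).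
Axioms: standard.
-/

namespace PercRepro

namespace TriangleCap

namespace C047

open Finset

variable {V : Type*} [Fintype V] [DecidableEq V]

omit [Fintype V] [DecidableEq V] in
/-- Convexity: `x + y = a + f`, `x, y ≤ a` ⇒ `x² + y² ≤ a² + f²`. -/
theorem sq_add_sq_le_of_sum {x y a f : ℕ} (hx : x ≤ a) (hy : y ≤ a) (hsum : x + y = a + f) :
    x * x + y * y ≤ a * a + f * f := by
  have hxf : f ≤ x := by omega
  have h : (x : ℤ) * x + y * y ≤ a * a + f * f := by
    have h1 : (f : ℤ) ≤ x := by exact_mod_cast hxf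
    have h2 : (x : ℤ) ≤ a := by exact_mod_cast hx
    have h3 : (x : ℤ) + y = a + f := by exact_mod_cast hsum
    nlinarith [mul_nonneg (sub_nonneg.mpr h1) (sub_nonneg.mpr h2)]
  exact_mod_cast h

omit [Fintype V] [DecidableEq V] in
/-- The arithmetic of the residue: `Σ deficit ≥ 6n` from the count, `sqP ≤ 2e + (n−2)² + (e − n + 2)²`,
`sq ≤ (n−2)² + 4`, `2n − 6 ≤ e ≤ 2n − 4`, `e ≠ 2n − 4`, `n ≥ 6`. -/
theorem residue_arith (n e sq sqP Def : ℕ) (hn : 6 ≤ n)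
    (hcount : 2 * n + 2 * (n * n) + n * (2 * e) ≤ Def + 2 * sqP + 2 * sq + 2 * e)
    (hsqP : sqP ≤ 2 * e + (n - 2) * (n - 2) + (e - (n - 2)) * (e - (n - 2)))
    (hsq : sq ≤ (n - 2) * (n - 2) + 4) (he1 : 2 * n ≤ e + 6) (he2 : e + 4 ≤ 2 * n) (he3 : e + 4 ≠ 2 * n) :
    6 * n ≤ Def := by
  obtain ⟨a, ha⟩ : ∃ a, n = a + 4 := ⟨n - 4, by omega⟩
  subst ha
  have ea : a + 4 - 2 = a + 2 := by omega
  rw [ea] at hsqP hsq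
  rcases Nat.lt_or_ge (e + 5) (2 * (a + 4)) with h5 | h5
  · have he : e = 2 * a + 2 := by omega
    subst he
    have ef : 2 * a + 2 - (a + 2) = a := by omega
    rw [ef] at hsqP
    nlinarith
  · have he : e = 2 * a + 3 := by omega
    subst he
    have ef : 2 * a + 3 - (a + 2) = a + 1 := by omega
    rw [ef] at hsqP
    nlinarith

/-- **THE RESIDUE:** `K₄⁻`-free, the only triangle `u v w`, no outer vertex, `n = |Sᶜ| ≥ 6`, the private sets of
`v` and `w` of total size `≤ 2`, `2m ≥ 6k − 24` and `2m ≠ 6k − 20` ⇒ `Σ_v d(v)² + 3 (k − 4) ≤ m k`. -/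
theorem one_triangle_stability_three_no_outer_residue (D : SimpleGraph V) [DecidableRel D.Adj] (hK : K4mFree D)
    {u v w : V} (huv : D.Adj u v) (huw : D.Adj u w) (hvw : D.Adj v w)
    (hT : ∀ a b c, D.Adj a b → D.Adj a c → D.Adj b c → a = u ∨ a = v ∨ a = w)
    (hq : ∀ z, z ∉ ({u, v, w} : Finset V) → 1 ≤ degIn D {u, v, w} z)
    (hn : 6 ≤ (({u, v, w} : Finset V)ᶜ).card)
    (hm : 6 * Fintype.card V ≤ 2 * D.edgeFinset.card + 24) (hm' : 2 * D.edgeFinset.card + 20 ≠ 6 * Fintype.card V)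
    (hbc : degIn D ({u, v, w} : Finset V)ᶜ v + degIn D ({u, v, w} : Finset V)ᶜ w ≤ 2) :
    ∑ v, deg D v * deg D v + 3 * (Fintype.card V - 4) ≤ D.edgeFinset.card * Fintype.card V := by
  obtain ⟨hcount, -, -, hdens⟩ := one_triangle_no_outer_count D hK huv huw hvw hT hq
  set S : Finset V := {u, v, w} with hS
  have h3 : S.card = 3 := card_triple huv.ne huw.ne hvw.ne
  have hk : Fintype.card V = Sᶜ.card + 3 := by
    have := card_add_card_compl S
    omega
  have hs1 : ∀ z ∈ Sᶜ, degIn D S z = 1 := by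
    intro z hz
    have h1 : degIn D S z ≤ 1 := degIn_le_one_of_triangle D hK huv huw hvw (mem_compl.mp hz)
    have h2 : 1 ≤ degIn D S z := hq z (mem_compl.mp hz)
    omega
  have hsum1 : ∑ z ∈ Sᶜ, degIn D S z = Sᶜ.card := by
    rw [sum_congr rfl hs1, sum_const, smul_eq_mul, mul_one]
  have hcomm := sum_degIn_comm D S Sᶜ
  rw [hsum1] at hcomm
  have huvw : u ∉ ({v, w} : Finset V) := by
    simp only [mem_insert, mem_singleton, not_or]; exact ⟨huv.ne, huw.ne⟩
  have hvw' : v ∉ ({w} : Finset V) := by simp only [mem_singleton]; exact hvw.ne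
  have e_sum : ∑ x ∈ S, degIn D Sᶜ x = degIn D Sᶜ u + (degIn D Sᶜ v + degIn D Sᶜ w) := by
    rw [hS, sum_insert huvw, sum_insert hvw', sum_singleton]
  have e_sq : ∑ x ∈ S, degIn D Sᶜ x * degIn D Sᶜ x =
      degIn D Sᶜ u * degIn D Sᶜ u + (degIn D Sᶜ v * degIn D Sᶜ v + degIn D Sᶜ w * degIn D Sᶜ w) := by
    rw [hS, sum_insert huvw, sum_insert hvw', sum_singleton]
  rw [e_sum] at hcomm
  rw [e_sq] at hcount
  -- no triangle with a vertex off `S`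
  have hnotri : ∀ y, y ∉ S → ∀ y' t, D.Adj y y' → D.Adj y t → D.Adj y' t → False := by
    intro y hy y' t h1 h2 h3'
    have := hT y y' t h1 h2 h3'
    rw [hS] at hy
    simp only [mem_insert, mem_singleton] at hy
    exact hy this
  -- the split `Sᶜ = A ∪ B`: `A = N(u) ∩ Sᶜ`, `B` the rest (the private sets of `v` and `w`)
  set A := Sᶜ.filter (fun z => D.Adj u z) with hA
  set B := Sᶜ.filter (fun z => ¬ D.Adj u z) with hB
  have hAB : A ∪ B = Sᶜ := filter_union_filter_not_eq _ _
  have hABd : Disjoint A B := disjoint_filter_filter_not _ _ _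
  have hAcard : A.card = degIn D Sᶜ u := rfl
  have hABcard : A.card + B.card = Sᶜ.card := card_filter_add_card_filter_not _
  have hBcard : B.card ≤ 2 := by omega
  have hAS : A ⊆ Sᶜ := filter_subset _ _
  have hBS : B ⊆ Sᶜ := filter_subset _ _
  -- `A` is independent
  have hAind : ∀ y ∈ A, degIn D A y = 0 := by
    intro y hy
    unfold degIn
    rw [card_eq_zero, filter_eq_empty_iff]
    intro y' hy' hyy'
    rw [hA, mem_filter] at hy hy'
    exact hnotri y (mem_compl.mp hy.1) y' u hyy' (D.adj_symm hy.2) (D.adj_symm hy'.2)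
  have hdA : ∀ y ∈ A, degIn D Sᶜ y = degIn D B y := by
    intro y hy
    rw [← hAB, degIn_union_of_disjoint D hABd y, hAind y hy, zero_add]
  have hdB : ∀ x ∈ B, degIn D Sᶜ x = degIn D A x + degIn D B x := by
    intro x _
    rw [← hAB, degIn_union_of_disjoint D hABd x]
  have hsplit : ∀ (f : V → ℕ), ∑ z ∈ Sᶜ, f z = ∑ z ∈ A, f z + ∑ z ∈ B, f z := fun f =>
    (sum_filter_add_sum_filter_not Sᶜ (fun z => D.Adj u z) f).symm
  have hcommAB := sum_degIn_comm D A B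
  have hQ'split : ∑ z ∈ Sᶜ, degIn D Sᶜ z = 2 * ∑ x ∈ B, degIn D A x + ∑ x ∈ B, degIn D B x := by
    rw [hsplit (degIn D Sᶜ), sum_congr rfl hdA, sum_congr rfl hdB, sum_add_distrib, hcommAB]
    ring
  have heA : ∑ x ∈ B, degIn D A x ≤ B.card * A.card := by
    calc ∑ x ∈ B, degIn D A x ≤ ∑ _x ∈ B, A.card := sum_le_sum (fun x _ => degIn_le_card D A x)
      _ = B.card * A.card := by rw [sum_const, smul_eq_mul]
  -- the density in terms of `Q′`
  have hdens' : 4 * Sᶜ.card ≤ ∑ z ∈ Sᶜ, degIn D Sᶜ z + 12 := by rw [hk] at hm; omega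
  rcases Nat.lt_or_ge B.card 2 with hB1 | hB2
  · -- `|B| ≤ 1`: `Q′ ≤ 2 (n − 1)`, not dense
    exfalso
    have hEB : ∑ x ∈ B, degIn D B x = 0 := by
      apply sum_eq_zero
      intro x hx
      have := degIn_le_card_sub_one D hx
      omega
    rw [hEB] at hQ'split
    interval_cases hB : B.card <;> omega
  · have hB2' : B.card = 2 := by omega
    obtain ⟨x, y, hxy, hBxy⟩ := card_eq_two.mp hB2'
    have hxB : x ∈ B := by rw [hBxy]; exact mem_insert_self _ _
    have hyB : y ∈ B := by rw [hBxy]; exact mem_insert_of_mem (mem_singleton_self _)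
    have hsumB : ∀ (f : V → ℕ), ∑ z ∈ B, f z = f x + f y := fun f => by
      rw [hBxy, sum_insert (by simpa using hxy), sum_singleton]
    by_cases hadj : D.Adj x y
    · -- `x ~ y`: disjoint neighbourhoods in `A`, `Q′ ≤ 2n − 2`, not dense
      exfalso
      have hdisj : Disjoint (A.filter (fun t => D.Adj x t)) (A.filter (fun t => D.Adj y t)) := by
        rw [disjoint_left]
        intro t ht1 ht2
        rw [mem_filter] at ht1 ht2
        exact hnotri x (mem_compl.mp (hBS hxB)) y t hadj ht1.2 ht2.2
      have hle := card_le_card (union_subset (filter_subset _ _) (filter_subset _ _) :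
        A.filter (fun t => D.Adj x t) ∪ A.filter (fun t => D.Adj y t) ⊆ A)
      rw [card_union_of_disjoint hdisj] at hle
      change degIn D A x + degIn D A y ≤ A.card at hle
      have hEB : ∑ z ∈ B, degIn D B z ≤ 2 := by
        rw [hsumB]
        have h1 := degIn_le_card_sub_one D hxB
        have h2 := degIn_le_card_sub_one D hyB
        omega
      rw [hsumB (degIn D A)] at hQ'split
      omega
    · -- `x ≁ y`: every edge inside `Sᶜ` joins `A` to `B`; convexity
      have hEB : ∑ z ∈ B, degIn D B z = 0 := by
        rw [hsumB]
        have e1 : degIn D B x = 0 := by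
          unfold degIn
          rw [card_eq_zero, filter_eq_empty_iff]
          intro t ht hxt
          rw [hBxy, mem_insert, mem_singleton] at ht
          rcases ht with rfl | rfl
          · exact hxt.ne rfl
          · exact hadj hxt
        have e2 : degIn D B y = 0 := by
          unfold degIn
          rw [card_eq_zero, filter_eq_empty_iff]
          intro t ht hyt
          rw [hBxy, mem_insert, mem_singleton] at ht
          rcases ht with rfl | rfl
          · exact hadj (D.adj_symm hyt)
          · exact hyt.ne rfl
        rw [e1, e2]
      rw [hEB, add_zero, hsumB (degIn D A)] at hQ'split
      -- `d(z) ≤ 2` on `A`, so `Σ_A d² ≤ 2 Σ_A d = 2 e`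
      have hsqA : ∑ z ∈ A, degIn D Sᶜ z * degIn D Sᶜ z ≤ 2 * (degIn D A x + degIn D A y) := by
        have h1 : ∑ z ∈ A, degIn D Sᶜ z * degIn D Sᶜ z ≤ ∑ z ∈ A, 2 * degIn D Sᶜ z := by
          apply sum_le_sum
          intro z hz
          have : degIn D Sᶜ z ≤ 2 := by
            rw [hdA z hz]
            have := degIn_le_card D B z
            omega
          exact Nat.mul_le_mul_right _ this
        have h2 : ∑ z ∈ A, degIn D Sᶜ z = degIn D A x + degIn D A y := by
          rw [sum_congr rfl hdA, hcommAB, hsumB]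
        rw [← mul_sum, h2] at h1
        exact h1
      have hsqB : ∑ z ∈ B, degIn D Sᶜ z * degIn D Sᶜ z = degIn D A x * degIn D A x + degIn D A y * degIn D A y := by
        rw [hsumB, hdB x hxB, hdB y hyB]
        have e1 : degIn D B x = 0 := by
          have := hsumB (degIn D B); omega
        have e2 : degIn D B y = 0 := by
          have := hsumB (degIn D B); omega
        rw [e1, e2, add_zero, add_zero]
      have hsqP : ∑ z ∈ Sᶜ, degIn D Sᶜ z * degIn D Sᶜ z ≤ 2 * (degIn D A x + degIn D A y) +
          (Sᶜ.card - 2) * (Sᶜ.card - 2) + (degIn D A x + degIn D A y - (Sᶜ.card - 2)) *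
            (degIn D A x + degIn D A y - (Sᶜ.card - 2)) := by
        rw [hsplit (fun z => degIn D Sᶜ z * degIn D Sᶜ z), hsqB]
        have hxA : degIn D A x ≤ Sᶜ.card - 2 := by have := degIn_le_card D A x; omega
        have hyA : degIn D A y ≤ Sᶜ.card - 2 := by have := degIn_le_card D A y; omega
        have hge : Sᶜ.card - 2 ≤ degIn D A x + degIn D A y := by omega
        have hconv := sq_add_sq_le_of_sum hxA hyA (a := Sᶜ.card - 2) (f := degIn D A x + degIn D A y - (Sᶜ.card - 2))
          (by omega)
        omega
      -- `sq ≤ (n − 2)² + 4`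
      have hsq : degIn D Sᶜ u * degIn D Sᶜ u + (degIn D Sᶜ v * degIn D Sᶜ v + degIn D Sᶜ w * degIn D Sᶜ w) ≤
          (Sᶜ.card - 2) * (Sᶜ.card - 2) + 4 := by
        have hu : degIn D Sᶜ u ≤ Sᶜ.card - 2 := by omega
        have hvw2 : degIn D Sᶜ v * degIn D Sᶜ v + degIn D Sᶜ w * degIn D Sᶜ w ≤ 4 := by
          have h1 := Nat.mul_le_mul hbc hbc
          nlinarith only [h1]
        have := Nat.mul_le_mul hu hu
        omega
      -- the degrees bound `e ≤ 2 (n − 2)`, and `e ≠ 2n − 4`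
      have hxA : degIn D A x ≤ Sᶜ.card - 2 := by have := degIn_le_card D A x; omega
      have hyA : degIn D A y ≤ Sᶜ.card - 2 := by have := degIn_le_card D A y; omega
      have hid := two_mul_sum_deg_sq_add_sum_deficit D
      have h6 := card_triangles3_le_six D hT
      rw [hk] at hid hm' ⊢
      rw [hQ'split] at hcount hdens hdens'
      have hDef := residue_arith Sᶜ.card (degIn D A x + degIn D A y) _ _ _ hn hcount hsqP hsq (by omega)
        (by omega) (by omega)
      have hmk : 2 * D.edgeFinset.card * (Sᶜ.card + 3) = 2 * (D.edgeFinset.card * (Sᶜ.card + 3)) := by ring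
      omega

/-- **THREE BELOW THE DIAGONAL, ONE TRIANGLE, NO OUTER VERTEX:** `K₄⁻`-free, the only triangle `u v w`, every vertex
off it adjacent to one of `u, v, w`, `k ≥ 9`, `2m ≥ 6k − 24`, `2m ≠ 6k − 20`, and `k ≥ 12` or `2m = 6k − 24` ⇒
`Σ_v d(v)² + 3 (k − 4) ≤ m k`. -/
theorem one_triangle_stability_three_no_outer (D : SimpleGraph V) [DecidableRel D.Adj] (hK : K4mFree D)
    {u v w : V} (huv : D.Adj u v) (huw : D.Adj u w) (hvw : D.Adj v w)
    (hT : ∀ a b c, D.Adj a b → D.Adj a c → D.Adj b c → a = u ∨ a = v ∨ a = w)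
    (hq : ∀ z, z ∉ ({u, v, w} : Finset V) → 1 ≤ degIn D {u, v, w} z)
    (hk : 9 ≤ Fintype.card V) (hm : 6 * Fintype.card V ≤ 2 * D.edgeFinset.card + 24)
    (hm' : 2 * D.edgeFinset.card + 20 ≠ 6 * Fintype.card V)
    (hA : 12 ≤ Fintype.card V ∨ 2 * D.edgeFinset.card + 24 = 6 * Fintype.card V) :
    ∑ v, deg D v * deg D v + 3 * (Fintype.card V - 4) ≤ D.edgeFinset.card * Fintype.card V := by
  obtain ⟨-, -, hQle, hdens⟩ := one_triangle_no_outer_count D hK huv huw hvw hT hq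
  by_cases hlarge : 4 * (({u, v, w} : Finset V)ᶜ).card +
      ∑ z ∈ ({u, v, w} : Finset V)ᶜ, degIn D ({u, v, w} : Finset V)ᶜ z +
      2 * ∑ x ∈ ({u, v, w} : Finset V), degIn D ({u, v, w} : Finset V)ᶜ x * degIn D ({u, v, w} : Finset V)ᶜ x ≤
      2 * ((({u, v, w} : Finset V)ᶜ).card * (({u, v, w} : Finset V)ᶜ).card)
  · exact one_triangle_stability_three_no_outer_of_large D hK huv huw hvw hT hq (by omega) hlarge
  push Not at hlarge
  set S : Finset V := {u, v, w} with hS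
  have h3 : S.card = 3 := card_triple huv.ne huw.ne hvw.ne
  have hk' : Fintype.card V = Sᶜ.card + 3 := by
    have := card_add_card_compl S
    omega
  have hs1 : ∀ z ∈ Sᶜ, degIn D S z = 1 := by
    intro z hz
    have h1 : degIn D S z ≤ 1 := degIn_le_one_of_triangle D hK huv huw hvw (mem_compl.mp hz)
    have h2 : 1 ≤ degIn D S z := hq z (mem_compl.mp hz)
    omega
  have hsum1 : ∑ z ∈ Sᶜ, degIn D S z = Sᶜ.card := by
    rw [sum_congr rfl hs1, sum_const, smul_eq_mul, mul_one]
  have hcomm := sum_degIn_comm D S Sᶜ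
  rw [hsum1] at hcomm
  have huvw : u ∉ ({v, w} : Finset V) := by
    simp only [mem_insert, mem_singleton, not_or]; exact ⟨huv.ne, huw.ne⟩
  have hvw' : v ∉ ({w} : Finset V) := by simp only [mem_singleton]; exact hvw.ne
  have e_sum : ∑ x ∈ S, degIn D Sᶜ x = degIn D Sᶜ u + (degIn D Sᶜ v + degIn D Sᶜ w) := by
    rw [hS, sum_insert huvw, sum_insert hvw', sum_singleton]
  have e_sq : ∑ x ∈ S, degIn D Sᶜ x * degIn D Sᶜ x =
      degIn D Sᶜ u * degIn D Sᶜ u + (degIn D Sᶜ v * degIn D Sᶜ v + degIn D Sᶜ w * degIn D Sᶜ w) := by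
    rw [hS, sum_insert huvw, sum_insert hvw', sum_singleton]
  rw [e_sum] at hcomm
  rw [e_sq] at hlarge hQle
  set a := degIn D Sᶜ u with ha
  set b := degIn D Sᶜ v with hb
  set c := degIn D Sᶜ w with hc
  set n := Sᶜ.card with hn
  set Q' := ∑ z ∈ Sᶜ, degIn D Sᶜ z with hQ'
  have hnn : n * n = a * a + (b * b + c * c) + 2 * (a * b + b * c + c * a) := by
    rw [← hcomm]; ring
  have hsig : (a * b + b * c + c * a + 4 ≤ 2 * n ∧ 6 ≤ n) ∨ (a * b + b * c + c * a < 2 * n ∧ 9 ≤ n) := by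
    rcases hA with hA | hA
    · right
      constructor
      · omega
      · omega
    · left
      constructor
      · omega
      · omega
  have hn6 : 6 ≤ n := by omega
  rcases partition_small_of_sigma_lt a b c n (by omega) hsig with h | h | h
  · exact one_triangle_stability_three_no_outer_residue D hK huv huw hvw hT hq hn6 hm hm' h
  · obtain ⟨-, -, p3, -, -⟩ := triple_perm (a := u) (b := v) (c := w)
    have hT' : ∀ a b c, D.Adj a b → D.Adj a c → D.Adj b c → a = v ∨ a = u ∨ a = w := by
      intro a b c h1 h2 h3
      rcases hT a b c h1 h2 h3 with h | h | h
      · exact Or.inr (Or.inl h)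
      · exact Or.inl h
      · exact Or.inr (Or.inr h)
    have hq' : ∀ z, z ∉ ({v, u, w} : Finset V) → 1 ≤ degIn D {v, u, w} z := by
      rw [p3]; exact hq
    have hn' : 6 ≤ (({v, u, w} : Finset V)ᶜ).card := by rw [p3]; exact hn6
    have h' : degIn D ({v, u, w} : Finset V)ᶜ u + degIn D ({v, u, w} : Finset V)ᶜ w ≤ 2 := by
      rw [p3]; exact h
    exact one_triangle_stability_three_no_outer_residue D hK huv.symm hvw huw hT' hq' hn' hm hm' h'
  · obtain ⟨-, p2, -, -, -⟩ := triple_perm (a := u) (b := v) (c := w)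
    have hT' : ∀ a b c, D.Adj a b → D.Adj a c → D.Adj b c → a = w ∨ a = u ∨ a = v := by
      intro a b c h1 h2 h3
      rcases hT a b c h1 h2 h3 with h | h | h
      · exact Or.inr (Or.inl h)
      · exact Or.inr (Or.inr h)
      · exact Or.inl h
    have hq' : ∀ z, z ∉ ({w, u, v} : Finset V) → 1 ≤ degIn D {w, u, v} z := by
      rw [p2]; exact hq
    have hn' : 6 ≤ (({w, u, v} : Finset V)ᶜ).card := by rw [p2]; exact hn6
    have h' : degIn D ({w, u, v} : Finset V)ᶜ u + degIn D ({w, u, v} : Finset V)ᶜ v ≤ 2 := by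
      rw [p2]; exact h
    exact one_triangle_stability_three_no_outer_residue D hK huw.symm hvw.symm huv hT' hq' hn' hm hm' h'

end C047

end TriangleCap

end PercRepro
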